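import Mathlib.Analysis.MellinTransform
import Mathlib.NumberTheory.LSeries.RiemannZeta
import Mathlib.Analysis.SpecialFunctions.Integrals.Basic
import Mathlib.Topology.EMetricSpace.BoundedVariation
import Literature.NumberTheory.LFunctions.MuentzFormulaStrip
import HarnessLib

/-!
# The truncation identity for Connes' prolate guess: `M_λ(s) = ζ(½+s)·𝓜h_λ(s+½) − B_λ(s)`

Connes 2026 (Letter, §6.4–6.5) and Connes–Consani–Moscovici 2025 (§7, proof of Lemma 7.3) work with the
Mellin transform `M_λ(s) = ∫_{λ^{-1}}^{λ} 𝓔(h_λ)(u) u^{s-1} du` of the prolate guess `k_λ = 𝓔(h_λ)` restricted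
to `[λ^{-1}, λ]` (the tree's `prolateGuessMellin`).  This file records, sorry-free, the elementary
bookkeeping that relates it to the full Mellin transform treated in `MuentzFormulaStrip.lean`
("Lemma M": `∫_0^∞ 𝓔(f)(u)u^{s-1}du = ζ(½+s)∫_0^∞ f(x)x^{s-½}dx` on `Re s > −½`, `s ≠ ½`, for `f`
Lipschitz on `[0,A]`, zero beyond `A`, `∫_0^A f = 0`):

* `connesE_eq_zero_of_lt` — `𝓔(f)(u) = 0` for `u > A` (the sum `Σ f(nu)` is empty), so truncating the
  `u`-integral at `λ` on top loses nothing;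
* `abs_connesE_le` — `|𝓔(f)(u)| ≤ √u·(L·A + M)` for all `u > 0` (`L` a Lipschitz constant, `M` a bound for
  `|f|` on `[0,A]`; Riemann-sum bound of `MuentzFormulaStrip.lean`, using `∫_0^A f = 0`), and the sharper
  **bounded-variation form** `abs_connesE_le_of_bv` — `|𝓔(f)(u)| ≤ √u·(V + M)` with `V` the total variation
  of `f` on `[0,A]` (`eVariationOn`; from the Riemann-sum estimate
  `norm_smul_tsum_indicator_comp_mul_nat_sub_integral_le_of_bv`: the oscillations of `f` on the cells
  `[(n-1)u, nu]` add up to at most `V`);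
* `setIntegral_Icc_connesE_eq` — the exact identity
  `∫_T^A 𝓔(f)(u)u^{s-1}du = ζ(½+s)·𝓜f(s+½) − ∫_0^T 𝓔(f)(u)u^{s-1}du` (`T > 0`), and
  `norm_setIntegral_Ioc_connesE_le_of_sqrt_bound` / `…_le` / `…_le_of_bv` — the tail bounds
  `‖∫_0^T 𝓔(f)(u)u^{s-1}du‖ ≤ C·T^{σ+½}/(σ+½)` (`σ = Re s > −½`) from `|𝓔(f)(u)| ≤ C√u`, with
  `C = LA + M` resp. `C = V + M`;
* for the prolate guess (`f = h_λ = prolateGuessH λ h_{0,λ} h_{4,λ}`, `A = λ`, `T = λ^{-1}`):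
  `prolateGuessMellin_eq` — `M_λ(s) = ζ(½+s)·𝓜h_λ(s+½) − B_λ(s)` with
  `B_λ(s) = ∫_0^{1/λ} 𝓔(h_λ)(u)u^{s-1}du`, and `norm_prolateGuessMellin_sub_le` /
  `norm_prolateGuessMellin_sub_le_of_even` — `‖M_λ(s) − ζ(½+s)·𝓜h_λ(s+½)‖ ≤ (L·λ + M)·λ^{-(σ+½)}/(σ+½)`
  for any Lipschitz constant `L` and bound `M` of `h_λ` on `[0, λ]`, and the bounded-variation forms
  `norm_prolateGuessMellin_sub_le_of_bv` / `…_of_bv_of_even` —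
  `‖B_λ(s)‖ ≤ (TV(h_λ;[0,λ]) + M)·λ^{-(σ+½)}/(σ+½)` (the bound `|4B_λ(s)| ≲ 4 TV(h_λ) λ^{-½-σ}/(½+σ)`
  quoted in analyses of Fact 6.4; whether `TV(h_λ;[0,λ])` stays bounded as `λ → ∞` is prolate
  asymptotics and is NOT addressed here).

This is the (RH-free, elementary) first half of the identity called (★) in analyses of the Letter's
Fact 6.4: the difference `4M_λ(s) − ξ(½+s)` is `4ζ(½+s)(𝓜h_λ − 𝓜h)(s+½) − 4B_λ(s)` once
`ξ(½+s) = 4ζ(½+s)𝓜h(s+½)` (CCM25 Lemma 7.1, file `RiemannXiMellinGaussian.lean`) is available; the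
`λ`-dependence of `L`, `M`, `TV(h_λ)` (prolate asymptotics) is exactly what Fact 6.4 needs and is NOT
addressed here.  Also included: the evenness
bookkeeping `∫_{-λ}^{λ} h_λ = 0 ⇒ ∫_0^λ h_λ = 0` for even `h_{0,λ}, h_{4,λ}` (Letter §6.3: "`h_{n,λ}` is even
when `n` is even"), which discharges the vanishing-integral hypothesis from the tree's
`integral_prolateGuessH_eq_zero`.
-/

open Real Complex Set MeasureTheory Filter Topology intervalIntegral

open scoped NNReal ENNReal

namespace Literature.NumberTheory.LFunctions

/-! ### Pointwise facts about `𝓔(f)` -/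

/-- `𝓔(f)(u) = 0` for `u > A` when `f` vanishes on `(A, ∞)`: every `n u` (`n ≥ 1`) exceeds `A`.
[folklore] -/
theorem connesE_eq_zero_of_lt {f : ℝ → ℝ} {A u : ℝ} (hsupp : ∀ x, A < x → f x = 0) (hu : 0 < u)
    (hAu : A < u) : connesE f u = 0 := by
  have h : ∀ n : ℕ, f (((n : ℝ) + 1) * u) = 0 := fun n ↦ hsupp _ (by
    have h1 : (0 : ℝ) ≤ (n : ℝ) := n.cast_nonneg
    exact hAu.trans_le (by nlinarith))
  have h' : ∀ n : ℕ, f (((n + 1 : ℕ) : ℝ) * u) = 0 := fun n ↦ by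
    rw [Nat.cast_add_one]; exact h n
  unfold connesE
  rw [tsum_congr h', tsum_zero, mul_zero]

/-- **Crude bound for `𝓔(f)`.**  If `f` is `L`-Lipschitz on `[0, A]` with `|f| ≤ M` there, vanishes on
`(A, ∞)` and `∫_0^A f = 0`, then `|𝓔(f)(u)| ≤ √u · (L·A + M)` for every `u > 0` (the Riemann sum
`u Σ_{n≥1} f(nu)` is within `(LA+M)u` of `∫_0^A f = 0`). [folklore] -/
theorem abs_connesE_le {f : ℝ → ℝ} {A M : ℝ} {L : ℝ≥0} (hA : 0 < A)
    (hLip : LipschitzOnWith L f (Icc 0 A)) (hsupp : ∀ x, A < x → f x = 0)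
    (hM : ∀ t ∈ Icc 0 A, |f t| ≤ M) (hint : ∫ t in (0 : ℝ)..A, f t = 0) {u : ℝ} (hu : 0 < u) :
    |connesE f u| ≤ Real.sqrt u * (L * A + M) := by
  set F₀ : ℝ → ℂ := fun t ↦ (f t : ℂ) with hF₀
  have hLip1 : LipschitzOnWith (1 * L) F₀ (Icc 0 A) :=
    Complex.isometry_ofReal.lipschitz.comp_lipschitzOnWith hLip
  have hLip' : LipschitzOnWith L F₀ (Icc 0 A) := by simpa using hLip1
  have hM' : ∀ t ∈ Icc 0 A, ‖F₀ t‖ ≤ M := fun t ht ↦ by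
    simpa [hF₀, Complex.norm_real, Real.norm_eq_abs] using hM t ht
  have hint' : ∫ t in (0 : ℝ)..A, F₀ t = 0 := by
    simp only [hF₀, intervalIntegral.integral_ofReal, hint, Complex.ofReal_zero]
  have hb := norm_tsum_indicator_comp_mul_nat_le hA hLip' hM' hint' hu
  have hFeq : ∀ x, 0 < x → (Ioc 0 A).indicator F₀ x = (f x : ℂ) := by
    intro x hx
    by_cases hxA : x ≤ A
    · exact indicator_of_mem (show x ∈ Ioc 0 A from ⟨hx, hxA⟩) F₀
    · rw [indicator_of_notMem (fun h ↦ hxA h.2), hsupp x (not_le.mp hxA)]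
      simp
  have hsum : ∑' n : ℕ, (Ioc 0 A).indicator F₀ (((n + 1 : ℕ) : ℝ) * u)
      = ((∑' n : ℕ, f (((n + 1 : ℕ) : ℝ) * u) : ℝ) : ℂ) := by
    rw [Complex.ofReal_tsum]
    exact tsum_congr fun n ↦ hFeq _ (by positivity)
  rw [hsum, Complex.norm_real, Real.norm_eq_abs] at hb
  rw [connesE, abs_mul, abs_of_nonneg (Real.sqrt_nonneg u)]
  exact mul_le_mul_of_nonneg_left hb (Real.sqrt_nonneg u)

/-! ### Bounded-variation form of the crude bound -/

/-- **Riemann-sum estimate, bounded-variation form.**  If `F₀` is continuous with total variation `V`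
on `[0, A]`, `‖F₀‖ ≤ M` there, and `F = 1_{(0,A]} F₀`, then for every `x > 0`,
`‖x Σ_{n ≥ 1} F(n x) − ∫_0^A F₀‖ ≤ (V + M) x` (each term is compared with `∫_{(n-1)x}^{nx} F₀`, the
oscillation on the cells adding up to at most `V`; the leftover `∫_{⌊A/x⌋x}^{A} F₀` is at most `M x`).
[folklore] -/
theorem norm_smul_tsum_indicator_comp_mul_nat_sub_integral_le_of_bv {E : Type*} [NormedAddCommGroup E]
    [NormedSpace ℝ E] [CompleteSpace E] {F₀ : ℝ → E} {A M : ℝ}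
    (hA : 0 < A) (hcont : ContinuousOn F₀ (Icc 0 A)) (hV : BoundedVariationOn F₀ (Icc 0 A))
    (hM : ∀ t ∈ Icc 0 A, ‖F₀ t‖ ≤ M) {x : ℝ} (hx : 0 < x) :
    ‖x • ∑' n : ℕ, (Ioc 0 A).indicator F₀ (((n + 1 : ℕ) : ℝ) * x) - ∫ t in (0 : ℝ)..A, F₀ t‖
      ≤ ((eVariationOn F₀ (Icc 0 A)).toReal + M) * x := by
  have hM0 : 0 ≤ M := (norm_nonneg _).trans (hM 0 ⟨le_rfl, hA.le⟩)
  set N : ℕ := ⌊A / x⌋₊ with hN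
  have hNx : (N : ℝ) * x ≤ A := by
    have : (N : ℝ) ≤ A / x := Nat.floor_le (div_nonneg hA.le hx.le)
    rwa [le_div_iff₀ hx] at this
  have hAN : A < (N + 1 : ℝ) * x := by
    have : A / x < (N : ℝ) + 1 := Nat.lt_floor_add_one _
    rwa [div_lt_iff₀ hx] at this
  -- the sum is finite
  have hsum : ∑' n : ℕ, (Ioc 0 A).indicator F₀ (((n + 1 : ℕ) : ℝ) * x)
      = ∑ n ∈ Finset.range N, F₀ (((n + 1 : ℕ) : ℝ) * x) := by
    rw [tsum_eq_sum (s := Finset.range N)]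
    · refine Finset.sum_congr rfl fun n hn ↦ ?_
      rw [Finset.mem_range] at hn
      have hmem : (((n + 1 : ℕ) : ℝ)) * x ∈ Ioc 0 A :=
        ⟨by positivity, calc (((n + 1 : ℕ) : ℝ)) * x ≤ (N : ℝ) * x := by gcongr; exact_mod_cast hn
          _ ≤ A := hNx⟩
      exact Set.indicator_of_mem hmem F₀
    · intro n hn
      rw [Finset.mem_range, not_lt] at hn
      refine Set.indicator_of_notMem (fun h ↦ ?_) _
      have h2 : (((n + 1 : ℕ) : ℝ)) * x ≤ A := h.2
      have hNn : (N : ℝ) ≤ n := by exact_mod_cast hn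
      push_cast at h2
      nlinarith [mul_le_mul_of_nonneg_right hNn hx.le]
  -- interval integrability on subintervals of `[0, A]`
  have hII : ∀ a b : ℝ, 0 ≤ a → a ≤ b → b ≤ A → IntervalIntegrable F₀ volume a b := by
    intro a b ha hab hb
    refine (hcont.mono ?_).intervalIntegrable
    rw [uIcc_of_le hab]
    exact Icc_subset_Icc ha hb
  -- split the integral at `N x`
  have hsplit : ∫ t in (0 : ℝ)..A, F₀ t
      = (∑ n ∈ Finset.range N, ∫ t in ((n : ℝ) * x)..(((n + 1 : ℕ) : ℝ) * x), F₀ t)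
        + ∫ t in ((N : ℝ) * x)..A, F₀ t := by
    have h1 : ∑ n ∈ Finset.range N, ∫ t in ((n : ℝ) * x)..(((n + 1 : ℕ) : ℝ) * x), F₀ t
        = ∫ t in ((0 : ℕ) : ℝ) * x..(N : ℝ) * x, F₀ t := by
      refine sum_integral_adjacent_intervals (a := fun k : ℕ ↦ (k : ℝ) * x) fun k hk ↦ ?_
      refine hII _ _ (by positivity) ?_ ?_
      · gcongr; exact_mod_cast (Nat.le_succ k)
      · calc (((k + 1 : ℕ) : ℝ)) * x ≤ (N : ℝ) * x := by gcongr; exact_mod_cast hk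
          _ ≤ A := hNx
    rw [h1, Nat.cast_zero, zero_mul]
    exact (integral_add_adjacent_intervals (hII _ _ le_rfl (by positivity) hNx)
      (hII _ _ (by positivity) hNx le_rfl)).symm
  -- the cells and their variations
  set S : ℕ → Set ℝ := fun n ↦ Icc 0 A ∩ Icc ((n : ℝ) * x) (((n : ℝ) + 1) * x) with hS
  have hVn : ∀ n, eVariationOn F₀ (S n) ≠ ∞ := fun n ↦
    (hV.mono inter_subset_left)
  have hchain : ∀ m : ℕ, m ≤ N →
      ∑ n ∈ Finset.range m, eVariationOn F₀ (S n) = eVariationOn F₀ (Icc 0 A ∩ Icc 0 ((m : ℝ) * x)) := by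
    intro m hm
    induction m with
    | zero =>
      rw [Finset.sum_range_zero, Nat.cast_zero, zero_mul]
      exact (eVariationOn.subsingleton F₀ (fun a ha b hb ↦ by
        have ha' : a = 0 := le_antisymm ha.2.2 ha.2.1
        have hb' : b = 0 := le_antisymm hb.2.2 hb.2.1
        rw [ha', hb'])).symm
    | succ m ih =>
      have hm' : m ≤ N := Nat.le_of_succ_le hm
      have hmN : (m : ℝ) ≤ N := by exact_mod_cast hm'
      have hmx : (m : ℝ) * x ≤ A := le_trans (mul_le_mul_of_nonneg_right hmN hx.le) hNx
      rw [Finset.sum_range_succ, ih hm', hS]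
      simp only
      rw [eVariationOn.Icc_add_Icc F₀ (s := Icc 0 A) (by positivity) (by nlinarith) ⟨by positivity, hmx⟩]
      push_cast
      ring_nf
  have hsumV : (∑ n ∈ Finset.range N, (eVariationOn F₀ (S n)).toReal)
      ≤ (eVariationOn F₀ (Icc 0 A)).toReal := by
    rw [← ENNReal.toReal_sum (fun n _ ↦ hVn n), hchain N le_rfl]
    exact ENNReal.toReal_mono hV (eVariationOn.mono F₀ inter_subset_left)
  -- termwise estimate
  have hterm : ∀ n ∈ Finset.range N,
      ‖x • F₀ (((n + 1 : ℕ) : ℝ) * x) - ∫ t in ((n : ℝ) * x)..(((n + 1 : ℕ) : ℝ) * x), F₀ t‖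
        ≤ (eVariationOn F₀ (S n)).toReal * x := by
    intro n hn
    rw [Finset.mem_range] at hn
    have hn1 : (((n + 1 : ℕ) : ℝ)) * x ≤ A :=
      calc (((n + 1 : ℕ) : ℝ)) * x ≤ (N : ℝ) * x := by gcongr; exact_mod_cast hn
        _ ≤ A := hNx
    have hlen : (((n + 1 : ℕ) : ℝ)) * x - (n : ℝ) * x = x := by push_cast; ring
    have hle : (n : ℝ) * x ≤ (((n + 1 : ℕ) : ℝ)) * x := by linarith
    have hIIn : IntervalIntegrable F₀ volume ((n : ℝ) * x) (((n + 1 : ℕ) : ℝ) * x) :=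
      hII _ _ (by positivity) hle hn1
    have hrw : x • F₀ (((n + 1 : ℕ) : ℝ) * x)
        - ∫ t in ((n : ℝ) * x)..(((n + 1 : ℕ) : ℝ) * x), F₀ t
        = ∫ t in ((n : ℝ) * x)..(((n + 1 : ℕ) : ℝ) * x), (F₀ (((n + 1 : ℕ) : ℝ) * x) - F₀ t) := by
      rw [intervalIntegral.integral_sub intervalIntegrable_const hIIn, intervalIntegral.integral_const,
        hlen]
    rw [hrw]
    have hmemS : ∀ t, (n : ℝ) * x ≤ t → t ≤ (((n + 1 : ℕ) : ℝ)) * x → t ∈ S n := by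
      intro t ht1 ht2
      refine ⟨⟨le_trans (by positivity) ht1, ht2.trans hn1⟩, ht1, ?_⟩
      push_cast at ht2
      exact ht2
    have hb := intervalIntegral.norm_integral_le_of_norm_le_const (a := (n : ℝ) * x)
      (b := (((n + 1 : ℕ) : ℝ)) * x) (C := (eVariationOn F₀ (S n)).toReal)
      (f := fun t ↦ F₀ (((n + 1 : ℕ) : ℝ) * x) - F₀ t) ?_
    · have hlen' : ((n : ℝ) + 1) * x - n * x = x := by ring
      simpa [hlen', abs_of_pos hx] using hb
    intro t ht
    rw [uIoc_of_le hle] at ht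
    have h := (hV.mono (inter_subset_left : S n ⊆ Icc 0 A)).dist_le
      (hmemS _ hle le_rfl) (hmemS t ht.1.le ht.2)
    rwa [dist_eq_norm] at h
  -- tail estimate
  have htail : ‖∫ t in ((N : ℝ) * x)..A, F₀ t‖ ≤ M * x := by
    have hb := intervalIntegral.norm_integral_le_of_norm_le_const (a := (N : ℝ) * x) (b := A) (C := M)
      (f := F₀) fun t ht ↦ ?_
    · refine hb.trans ?_
      rw [abs_of_nonneg (by linarith)]
      gcongr
      linarith
    · rw [uIoc_of_le hNx] at ht
      exact hM t ⟨le_trans (by positivity) ht.1.le, ht.2⟩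
  -- assemble
  rw [hsum, hsplit, Finset.smul_sum, ← sub_sub, ← Finset.sum_sub_distrib]
  calc ‖(∑ n ∈ Finset.range N, (x • F₀ (((n + 1 : ℕ) : ℝ) * x)
          - ∫ t in ((n : ℝ) * x)..(((n + 1 : ℕ) : ℝ) * x), F₀ t)) - ∫ t in ((N : ℝ) * x)..A, F₀ t‖
      ≤ ‖∑ n ∈ Finset.range N, (x • F₀ (((n + 1 : ℕ) : ℝ) * x)
          - ∫ t in ((n : ℝ) * x)..(((n + 1 : ℕ) : ℝ) * x), F₀ t)‖ + ‖∫ t in ((N : ℝ) * x)..A, F₀ t‖ :=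
        norm_sub_le _ _
    _ ≤ (∑ n ∈ Finset.range N, (eVariationOn F₀ (S n)).toReal * x) + M * x := by
        gcongr
        exact (norm_sum_le _ _).trans (Finset.sum_le_sum hterm)
    _ = (∑ n ∈ Finset.range N, (eVariationOn F₀ (S n)).toReal) * x + M * x := by
        rw [Finset.sum_mul]
    _ ≤ (eVariationOn F₀ (Icc 0 A)).toReal * x + M * x := by gcongr
    _ = ((eVariationOn F₀ (Icc 0 A)).toReal + M) * x := by ring

/-- With `∫_0^A F₀ = 0`: `‖Σ_{n ≥ 1} F(n x)‖ ≤ V + M` for all `x > 0` (`F = 1_{(0,A]} F₀`, `V` the total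
variation and `M` a bound of `F₀` on `[0, A]`). [folklore] -/
theorem norm_tsum_indicator_comp_mul_nat_le_of_bv {E : Type*} [NormedAddCommGroup E]
    [NormedSpace ℝ E] [CompleteSpace E] {F₀ : ℝ → E} {A M : ℝ}
    (hA : 0 < A) (hcont : ContinuousOn F₀ (Icc 0 A)) (hV : BoundedVariationOn F₀ (Icc 0 A))
    (hM : ∀ t ∈ Icc 0 A, ‖F₀ t‖ ≤ M) (hint : ∫ t in (0 : ℝ)..A, F₀ t = 0) {x : ℝ} (hx : 0 < x) :
    ‖∑' n : ℕ, (Ioc 0 A).indicator F₀ (((n + 1 : ℕ) : ℝ) * x)‖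
      ≤ (eVariationOn F₀ (Icc 0 A)).toReal + M := by
  have h := norm_smul_tsum_indicator_comp_mul_nat_sub_integral_le_of_bv hA hcont hV hM hx
  rw [hint, sub_zero, norm_smul, Real.norm_eq_abs, abs_of_pos hx] at h
  exact le_of_mul_le_mul_left (by linarith) hx


/-- **Crude bound for `𝓔(f)`, bounded-variation form.**  If `f` is continuous with total variation `V`
on `[0, A]` (`V = eVariationOn f [0,A]`, finite), `|f| ≤ M` there, `f` vanishes on `(A, ∞)` and
`∫_0^A f = 0`, then `|𝓔(f)(u)| ≤ √u · (V + M)` for every `u > 0`.  (This is the form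
`|𝓔(h_λ)(u)| ≤ u^{1/2}·TV(h_λ)` used in analyses of the Letter's Fact 6.4, the endpoint value being
absorbed in `M`.) [folklore] -/
theorem abs_connesE_le_of_bv {f : ℝ → ℝ} {A M : ℝ} (hA : 0 < A)
    (hcont : ContinuousOn f (Icc 0 A)) (hV : BoundedVariationOn f (Icc 0 A))
    (hsupp : ∀ x, A < x → f x = 0) (hM : ∀ t ∈ Icc 0 A, |f t| ≤ M)
    (hint : ∫ t in (0 : ℝ)..A, f t = 0) {u : ℝ} (hu : 0 < u) :
    |connesE f u| ≤ Real.sqrt u * ((eVariationOn f (Icc 0 A)).toReal + M) := by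
  have hM' : ∀ t ∈ Icc 0 A, ‖f t‖ ≤ M := fun t ht ↦ by rw [Real.norm_eq_abs]; exact hM t ht
  have hb := norm_tsum_indicator_comp_mul_nat_le_of_bv hA hcont hV hM' hint hu
  have hFeq : ∀ x, 0 < x → (Ioc 0 A).indicator f x = f x := by
    intro x hx
    by_cases hxA : x ≤ A
    · exact indicator_of_mem (show x ∈ Ioc 0 A from ⟨hx, hxA⟩) f
    · rw [indicator_of_notMem (fun h ↦ hxA h.2), hsupp x (not_le.mp hxA)]
  have hsum : ∑' n : ℕ, (Ioc 0 A).indicator f (((n + 1 : ℕ) : ℝ) * u)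
      = ∑' n : ℕ, f (((n + 1 : ℕ) : ℝ) * u) :=
    tsum_congr fun n ↦ hFeq _ (by positivity)
  rw [hsum, Real.norm_eq_abs] at hb
  rw [connesE, abs_mul, abs_of_nonneg (Real.sqrt_nonneg u)]
  exact mul_le_mul_of_nonneg_left hb (Real.sqrt_nonneg u)

/-! ### The truncation identity and the crude tail bound -/

/-- **Truncation identity.**  Under the hypotheses of Lemma M (`f` Lipschitz on `[0,A]`, zero beyond `A`,
`∫_0^A f = 0`; `Re s > −½`, `s ≠ ½`) and for any cut `T > 0`:
`∫_{[T,A]} 𝓔(f)(u) u^{s-1} du = ζ(½+s)·∫_0^∞ f(x)x^{s-½}dx − ∫_{(0,T]} 𝓔(f)(u) u^{s-1} du`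
(the piece `u > A` of the Mellin integral vanishes identically).  With `A = λ`, `T = λ^{-1}`, `f = h_λ`
the left side is the tree's `prolateGuessMellin`. [cite: ConnesConsaniMoscovici2025, §7 proof of Lemma 7.3] -/
theorem setIntegral_Icc_connesE_eq {f : ℝ → ℝ} {A : ℝ} {L : ℝ≥0} (hA : 0 < A)
    (hLip : LipschitzOnWith L f (Icc 0 A)) (hsupp : ∀ x, A < x → f x = 0)
    (hint : ∫ t in (0 : ℝ)..A, f t = 0) {s : ℂ} (hs : -(1 / 2 : ℝ) < s.re) (hs1 : s ≠ 1 / 2)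
    {T : ℝ} (hT : 0 < T) :
    ∫ u in Icc T A, (connesE f u : ℂ) * (u : ℂ) ^ (s - 1) =
      riemannZeta (s + 1 / 2) * mellin (fun x ↦ (f x : ℂ)) (s + 1 / 2)
        - ∫ u in Ioc 0 T, (connesE f u : ℂ) * (u : ℂ) ^ (s - 1) := by
  obtain ⟨hconv, heq⟩ := mellin_connesE_of_integral_eq_zero hA hLip hsupp hint hs hs1
  set g : ℝ → ℂ := fun u ↦ (u : ℂ) ^ (s - 1) • (connesE f u : ℂ) with hg
  have hfun : (fun u : ℝ ↦ (connesE f u : ℂ) * (u : ℂ) ^ (s - 1)) = g := by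
    funext u; simp only [hg, smul_eq_mul]; exact mul_comm _ _
  have hIoi : IntegrableOn g (Ioi 0) := hconv
  have hU : Ioi (0 : ℝ) = Ioc 0 T ∪ Ioi T := by
    ext x
    simp only [mem_Ioi, mem_union, mem_Ioc]
    constructor
    · intro hx
      by_cases hxT : x ≤ T
      · exact Or.inl ⟨hx, hxT⟩
      · exact Or.inr (not_le.mp hxT)
    · rintro (⟨hx, -⟩ | hx)
      · exact hx
      · exact hT.trans hx
  have hdisj : Disjoint (Ioc (0 : ℝ) T) (Ioi T) :=
    Set.disjoint_left.mpr fun x hx hx' ↦ (not_lt.mpr hx.2) (mem_Ioi.mp hx')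
  have h1 : IntegrableOn g (Ioc 0 T) := hIoi.mono_set (hU ▸ subset_union_left)
  have h2 : IntegrableOn g (Ioi T) := hIoi.mono_set (hU ▸ subset_union_right)
  have hsplit : mellin (fun u ↦ (connesE f u : ℂ)) s = (∫ u in Ioc 0 T, g u) + ∫ u in Ioi T, g u := by
    rw [mellin, hU]
    exact setIntegral_union hdisj measurableSet_Ioi h1 h2
  have hzero : ∀ x ∈ Ioi T \ Ioc T A, g x = 0 := by
    intro x hx
    have hxT : T < x := hx.1
    have hxA : A < x := by
      by_contra h
      exact hx.2 ⟨hxT, not_lt.mp h⟩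
    simp [hg, connesE_eq_zero_of_lt hsupp (hT.trans hxT) hxA]
  have htop : ∫ u in Ioi T, g u = ∫ u in Icc T A, g u := by
    rw [setIntegral_eq_of_subset_of_forall_sdiff_eq_zero measurableSet_Ioi Ioc_subset_Ioi_self hzero,
      integral_Icc_eq_integral_Ioc]
  rw [hfun, ← htop]
  linear_combination heq - hsplit

/-- **Tail bound from a square-root bound.**  If `|𝓔(f)(u)| ≤ C√u` on `(0, T]`, then for
`σ = Re s > −½`: `‖∫_{(0,T]} 𝓔(f)(u) u^{s-1} du‖ ≤ C · T^{σ+½} / (σ+½)`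
(from `|𝓔(f)(u)u^{s-1}| ≤ C u^{σ−½}`). [folklore] -/
theorem norm_setIntegral_Ioc_connesE_le_of_sqrt_bound {f : ℝ → ℝ} {C T : ℝ}
    (hT : 0 < T) (hE : ∀ u ∈ Ioc 0 T, |connesE f u| ≤ Real.sqrt u * C) {s : ℂ}
    (hs : -(1 / 2 : ℝ) < s.re) :
    ‖∫ u in Ioc 0 T, (connesE f u : ℂ) * (u : ℂ) ^ (s - 1)‖ ≤
      C * T ^ (s.re + 1 / 2) / (s.re + 1 / 2) := by
  have hσ : -1 < s.re - 1 / 2 := by linarith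
  have hσ' : 0 < s.re + 1 / 2 := by linarith
  -- the dominating function and its integral
  have hgi : IntegrableOn (fun u : ℝ ↦ C * u ^ (s.re - 1 / 2)) (Ioc 0 T) := by
    have h := (intervalIntegral.intervalIntegrable_rpow' (a := 0) (b := T) hσ)
    rw [intervalIntegrable_iff_integrableOn_Ioc_of_le hT.le] at h
    exact h.const_mul _
  have hgint : ∫ u in Ioc 0 T, C * u ^ (s.re - 1 / 2)
      = C * T ^ (s.re + 1 / 2) / (s.re + 1 / 2) := by
    rw [← intervalIntegral.integral_of_le hT.le, intervalIntegral.integral_const_mul,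
      integral_rpow (Or.inl hσ), Real.zero_rpow (by linarith), sub_zero,
      show s.re - 1 / 2 + 1 = s.re + 1 / 2 by ring, mul_div_assoc]
  -- pointwise bound
  have hpt : ∀ u ∈ Ioc (0 : ℝ) T,
      ‖(connesE f u : ℂ) * (u : ℂ) ^ (s - 1)‖ ≤ C * u ^ (s.re - 1 / 2) := by
    intro u hu
    have hu0 : 0 < u := hu.1
    rw [norm_mul, Complex.norm_real, Real.norm_eq_abs, Complex.norm_cpow_eq_rpow_re_of_pos hu0,
      sub_re, one_re]
    have hb := hE u hu
    calc |connesE f u| * u ^ (s.re - 1)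
        ≤ Real.sqrt u * C * u ^ (s.re - 1) :=
          mul_le_mul_of_nonneg_right hb (Real.rpow_nonneg hu0.le _)
      _ = C * u ^ (s.re - 1 / 2) := by
          rw [Real.sqrt_eq_rpow, show s.re - 1 / 2 = 1 / 2 + (s.re - 1) by ring,
            Real.rpow_add hu0]
          ring
  calc ‖∫ u in Ioc 0 T, (connesE f u : ℂ) * (u : ℂ) ^ (s - 1)‖
      ≤ ∫ u in Ioc 0 T, C * u ^ (s.re - 1 / 2) :=
        norm_integral_le_of_norm_le hgi (ae_restrict_of_forall_mem measurableSet_Ioc hpt)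
    _ = C * T ^ (s.re + 1 / 2) / (s.re + 1 / 2) := hgint

/-- **Crude bound for the boundary piece.**  Under the hypotheses of `abs_connesE_le` and for
`σ = Re s > −½`, `T > 0`: `‖∫_{(0,T]} 𝓔(f)(u) u^{s-1} du‖ ≤ (L·A + M) · T^{σ+½} / (σ+½)`. [folklore] -/
theorem norm_setIntegral_Ioc_connesE_le {f : ℝ → ℝ} {A M : ℝ} {L : ℝ≥0} (hA : 0 < A)
    (hLip : LipschitzOnWith L f (Icc 0 A)) (hsupp : ∀ x, A < x → f x = 0)
    (hM : ∀ t ∈ Icc 0 A, |f t| ≤ M) (hint : ∫ t in (0 : ℝ)..A, f t = 0) {s : ℂ}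
    (hs : -(1 / 2 : ℝ) < s.re) {T : ℝ} (hT : 0 < T) :
    ‖∫ u in Ioc 0 T, (connesE f u : ℂ) * (u : ℂ) ^ (s - 1)‖ ≤
      (L * A + M) * T ^ (s.re + 1 / 2) / (s.re + 1 / 2) :=
  norm_setIntegral_Ioc_connesE_le_of_sqrt_bound hT
    (fun _ hu ↦ abs_connesE_le hA hLip hsupp hM hint hu.1) hs

/-- **Crude bound for the boundary piece, bounded-variation form**: for `f` continuous with total
variation `V` and bound `M` on `[0,A]`, zero beyond `A`, `∫_0^A f = 0`, and `σ = Re s > −½`, `T > 0`: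
`‖∫_{(0,T]} 𝓔(f)(u) u^{s-1} du‖ ≤ (V + M) · T^{σ+½} / (σ+½)`. [folklore] -/
theorem norm_setIntegral_Ioc_connesE_le_of_bv {f : ℝ → ℝ} {A M : ℝ} (hA : 0 < A)
    (hcont : ContinuousOn f (Icc 0 A)) (hV : BoundedVariationOn f (Icc 0 A))
    (hsupp : ∀ x, A < x → f x = 0) (hM : ∀ t ∈ Icc 0 A, |f t| ≤ M)
    (hint : ∫ t in (0 : ℝ)..A, f t = 0) {s : ℂ} (hs : -(1 / 2 : ℝ) < s.re) {T : ℝ} (hT : 0 < T) :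
    ‖∫ u in Ioc 0 T, (connesE f u : ℂ) * (u : ℂ) ^ (s - 1)‖ ≤
      ((eVariationOn f (Icc 0 A)).toReal + M) * T ^ (s.re + 1 / 2) / (s.re + 1 / 2) :=
  norm_setIntegral_Ioc_connesE_le_of_sqrt_bound hT
    (fun _ hu ↦ abs_connesE_le_of_bv hA hcont hV hsupp hM hint hu.1) hs

/-- **Truncated Lemma M with the crude tail bound.**  Under the hypotheses above, for `Re s = σ > −½`,
`s ≠ ½`, `T > 0`:
`‖∫_{[T,A]} 𝓔(f)(u)u^{s-1}du − ζ(½+s)∫_0^∞ f(x)x^{s-½}dx‖ ≤ (L·A + M)·T^{σ+½}/(σ+½)`. [folklore] -/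
theorem norm_setIntegral_Icc_connesE_sub_le {f : ℝ → ℝ} {A M : ℝ} {L : ℝ≥0} (hA : 0 < A)
    (hLip : LipschitzOnWith L f (Icc 0 A)) (hsupp : ∀ x, A < x → f x = 0)
    (hM : ∀ t ∈ Icc 0 A, |f t| ≤ M) (hint : ∫ t in (0 : ℝ)..A, f t = 0) {s : ℂ}
    (hs : -(1 / 2 : ℝ) < s.re) (hs1 : s ≠ 1 / 2) {T : ℝ} (hT : 0 < T) :
    ‖(∫ u in Icc T A, (connesE f u : ℂ) * (u : ℂ) ^ (s - 1))
        - riemannZeta (s + 1 / 2) * mellin (fun x ↦ (f x : ℂ)) (s + 1 / 2)‖ ≤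
      (L * A + M) * T ^ (s.re + 1 / 2) / (s.re + 1 / 2) := by
  rw [setIntegral_Icc_connesE_eq hA hLip hsupp hint hs hs1 hT, sub_sub_cancel_left, norm_neg]
  exact norm_setIntegral_Ioc_connesE_le hA hLip hsupp hM hint hs hT

/-- A Lipschitz function on `[0, A]` has bounded variation there. [folklore] -/
theorem boundedVariationOn_Icc_of_lipschitzOnWith {f : ℝ → ℝ} {A : ℝ} {L : ℝ≥0} (hA : 0 ≤ A)
    (hLip : LipschitzOnWith L f (Icc 0 A)) : BoundedVariationOn f (Icc 0 A) := by
  have h := hLip.locallyBoundedVariationOn 0 A ⟨le_rfl, hA⟩ ⟨hA, le_rfl⟩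
  rwa [inter_self] at h

/-- **Truncated Lemma M with the bounded-variation tail bound**: as `norm_setIntegral_Icc_connesE_sub_le`,
with the constant `L·A + M` replaced by `V + M`, `V` the total variation of `f` on `[0, A]`. [folklore] -/
theorem norm_setIntegral_Icc_connesE_sub_le_of_bv {f : ℝ → ℝ} {A M : ℝ} {L : ℝ≥0} (hA : 0 < A)
    (hLip : LipschitzOnWith L f (Icc 0 A)) (hsupp : ∀ x, A < x → f x = 0)
    (hM : ∀ t ∈ Icc 0 A, |f t| ≤ M) (hint : ∫ t in (0 : ℝ)..A, f t = 0) {s : ℂ}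
    (hs : -(1 / 2 : ℝ) < s.re) (hs1 : s ≠ 1 / 2) {T : ℝ} (hT : 0 < T) :
    ‖(∫ u in Icc T A, (connesE f u : ℂ) * (u : ℂ) ^ (s - 1))
        - riemannZeta (s + 1 / 2) * mellin (fun x ↦ (f x : ℂ)) (s + 1 / 2)‖ ≤
      ((eVariationOn f (Icc 0 A)).toReal + M) * T ^ (s.re + 1 / 2) / (s.re + 1 / 2) := by
  rw [setIntegral_Icc_connesE_eq hA hLip hsupp hint hs hs1 hT, sub_sub_cancel_left, norm_neg]
  exact norm_setIntegral_Ioc_connesE_le_of_bv hA hLip.continuousOn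
    (boundedVariationOn_Icc_of_lipschitzOnWith hA.le hLip) hsupp hM hint hs hT

/-! ### The prolate guess: `M_λ(s) = ζ(½+s)𝓜h_λ(s+½) − B_λ(s)` -/

/-- For an even function, `∫_{-a}^{a} f = 2 ∫_0^a f`. [folklore] -/
theorem integral_neg_self_eq_two_mul_of_even {f : ℝ → ℝ} {a : ℝ} (ha : 0 ≤ a)
    (hf : ∀ x, f (-x) = f x) (hfi : IntervalIntegrable f volume (-a) a) :
    ∫ x in (-a)..a, f x = 2 * ∫ x in (0 : ℝ)..a, f x := by
  have hsub1 : uIcc (-a) 0 ⊆ uIcc (-a) a := by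
    rw [uIcc_of_le (by linarith), uIcc_of_le (by linarith)]; exact Icc_subset_Icc le_rfl ha
  have hsub2 : uIcc 0 a ⊆ uIcc (-a) a := by
    rw [uIcc_of_le ha, uIcc_of_le (by linarith)]; exact Icc_subset_Icc (by linarith) le_rfl
  have h1 : IntervalIntegrable f volume (-a) 0 := hfi.mono_set hsub1
  have h2 : IntervalIntegrable f volume 0 a := hfi.mono_set hsub2
  have hneg : ∫ x in (-a)..0, f x = ∫ x in (0 : ℝ)..a, f x := by
    have h := intervalIntegral.integral_comp_neg (a := 0) (b := a) (f := f)
    simp only [hf, neg_zero] at h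
    exact h.symm
  rw [← integral_add_adjacent_intervals h1 h2, hneg, two_mul]

/-- `∫_0^λ h_λ = 0` for the prolate guess with even `h_{0,λ}`, `h_{4,λ}` and `∫ h_{0,λ} ≠ 0`: the Letter's
defining property `∫_{-λ}^{λ} h_λ = 0` (`integral_prolateGuessH_eq_zero`) halved by evenness (Connes 2026,
Letter §6.3: "`h_{n,λ}` is even when `n` is even"; evenness is not a field of `IsProlateFunction`, so it is
assumed). [cite: Connes2026Letter, §6.3–6.4] -/
theorem integral_zero_lam_prolateGuessH_eq_zero {lam : ℝ} {f0 f4 : ℝ → ℝ}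
    (h0 : IsProlateFunction lam 0 f0) (h4 : IsProlateFunction lam 4 f4)
    (he0 : ∀ x, f0 (-x) = f0 x) (he4 : ∀ x, f4 (-x) = f4 x) (hI : (∫ y in (-lam)..lam, f0 y) ≠ 0) :
    ∫ t in (0 : ℝ)..lam, prolateGuessH lam f0 f4 t = 0 := by
  have hlam : 0 < lam := h0.lam_pos
  have hII : ∀ {g : ℝ → ℝ} {n : ℕ}, IsProlateFunction lam n g →
      IntervalIntegrable g volume (-lam) lam :=
    fun hg ↦ (hg.contDiffOn.continuousOn.mono (by rw [uIcc_of_le (by linarith)])).intervalIntegrable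
  have hz : ∫ x in (-lam)..lam, prolateGuessH lam f0 f4 x = 0 :=
    integral_prolateGuessH_eq_zero lam f0 f4 (hII h0) (hII h4) hI
  have hev : ∀ x, prolateGuessH lam f0 f4 (-x) = prolateGuessH lam f0 f4 x := fun x ↦ by
    simp only [prolateGuessH, he0 x, he4 x]
  have hfi : IntervalIntegrable (prolateGuessH lam f0 f4) volume (-lam) lam := by
    unfold prolateGuessH
    exact ((hII h4).sub ((hII h0).const_mul _)).const_mul _
  have h2 := integral_neg_self_eq_two_mul_of_even hlam.le hev hfi
  linarith

/-- **Lemma M for the prolate guess, evenness form**: `mellin_connesE_prolateGuessH` with the hypothesis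
`∫_0^λ h_λ = 0` discharged by `integral_zero_lam_prolateGuessH_eq_zero`. [cite: Connes2026Letter, §6.3–6.4] -/
theorem mellin_connesE_prolateGuessH_of_even {lam : ℝ} {f0 f4 : ℝ → ℝ} (h0 : IsProlateFunction lam 0 f0)
    (h4 : IsProlateFunction lam 4 f4) (he0 : ∀ x, f0 (-x) = f0 x) (he4 : ∀ x, f4 (-x) = f4 x)
    (hI : (∫ y in (-lam)..lam, f0 y) ≠ 0) {s : ℂ} (hs : -(1 / 2 : ℝ) < s.re) (hs1 : s ≠ 1 / 2) :
    MellinConvergent (fun u ↦ (connesE (prolateGuessH lam f0 f4) u : ℂ)) s ∧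
      mellin (fun u ↦ (connesE (prolateGuessH lam f0 f4) u : ℂ)) s =
        riemannZeta (s + 1 / 2) * mellin (fun x ↦ (prolateGuessH lam f0 f4 x : ℂ)) (s + 1 / 2) :=
  mellin_connesE_prolateGuessH h0 h4 (integral_zero_lam_prolateGuessH_eq_zero h0 h4 he0 he4 hI) hs hs1

/-- Regularity package for `h_λ` used below: it is `C²` on `[−λ, λ]`, hence Lipschitz on `[0, λ]`, and
vanishes beyond `λ`. [folklore] -/
theorem prolateGuessH_lipschitz_support {lam : ℝ} {f0 f4 : ℝ → ℝ} (h0 : IsProlateFunction lam 0 f0)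
    (h4 : IsProlateFunction lam 4 f4) :
    (∃ L : ℝ≥0, LipschitzOnWith L (prolateGuessH lam f0 f4) (Icc 0 lam)) ∧
      ∀ x, lam < x → prolateGuessH lam f0 f4 x = 0 := by
  have hlam : 0 < lam := h0.lam_pos
  have hdef : prolateGuessH lam f0 f4 = fun x ↦ (Real.sqrt 3 / (2 : ℝ) ^ ((11 : ℝ) / 4)) *
      (f4 x - ((∫ y in (-lam)..lam, f4 y) / (∫ y in (-lam)..lam, f0 y)) * f0 x) := rfl
  have hcd : ContDiffOn ℝ 2 (prolateGuessH lam f0 f4) (Icc (-lam) lam) := by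
    rw [hdef]
    exact contDiffOn_const.mul (h4.contDiffOn.sub (contDiffOn_const.mul h0.contDiffOn))
  obtain ⟨L, hL⟩ := exists_lipschitzOnWith_of_contDiffOn_Icc (by linarith) hcd (by norm_num)
  refine ⟨⟨L, hL.mono (Icc_subset_Icc (by linarith) le_rfl)⟩, ?_⟩
  intro x hx
  have hx' : lam < |x| := by rwa [abs_of_pos (hlam.trans hx)]
  simp [hdef, h0.support x hx', h4.support x hx']

/-- **(★), first half: `M_λ(s) = ζ(½+s)·𝓜h_λ(s+½) − B_λ(s)`.**  For prolate functions `h_{0,λ}, h_{4,λ}`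
(`IsProlateFunction`), `h_λ = prolateGuessH λ h_{0,λ} h_{4,λ}` with `∫_0^λ h_λ = 0`, and `Re s > −½`,
`s ≠ ½`: the tree's truncated Mellin transform `prolateGuessMellin λ h_{0,λ} h_{4,λ} s =
∫_{[1/λ, λ]} 𝓔(h_λ)(u)u^{s-1}du` equals `ζ(½+s)·∫_0^λ h_λ(x)x^{s-½}dx − ∫_{(0,1/λ]} 𝓔(h_λ)(u)u^{s-1}du`.
(Connes–Consani–Moscovici 2025, proof of Lemma 7.3: "It remains to control the remainder in the Mellin
transform"; here the remainder above `λ` is identically zero.)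
[cite: ConnesConsaniMoscovici2025, §7 proof of Lemma 7.3] -/
theorem prolateGuessMellin_eq {lam : ℝ} {f0 f4 : ℝ → ℝ} (h0 : IsProlateFunction lam 0 f0)
    (h4 : IsProlateFunction lam 4 f4) (hint : ∫ t in (0 : ℝ)..lam, prolateGuessH lam f0 f4 t = 0)
    {s : ℂ} (hs : -(1 / 2 : ℝ) < s.re) (hs1 : s ≠ 1 / 2) :
    prolateGuessMellin lam f0 f4 s =
      riemannZeta (s + 1 / 2) * mellin (fun x ↦ (prolateGuessH lam f0 f4 x : ℂ)) (s + 1 / 2)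
        - ∫ u in Ioc 0 (1 / lam), (connesE (prolateGuessH lam f0 f4) u : ℂ) * (u : ℂ) ^ (s - 1) := by
  have hlam : 0 < lam := h0.lam_pos
  obtain ⟨⟨L, hL⟩, hsupp⟩ := prolateGuessH_lipschitz_support h0 h4
  exact setIntegral_Icc_connesE_eq hlam hL hsupp hint hs hs1 (one_div_pos.mpr hlam)

/-- **Crude rate for the truncation.**  With `L` any Lipschitz constant and `M` any bound of `h_λ` on
`[0, λ]`, `∫_0^λ h_λ = 0`, `σ = Re s > −½`, `s ≠ ½`:
`‖M_λ(s) − ζ(½+s)·𝓜h_λ(s+½)‖ ≤ (L·λ + M) · λ^{-(σ+½)} / (σ+½)`.  The `λ`-dependence of `L`, `M` is the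
content of Fact 6.4 and is not addressed. [cite: ConnesConsaniMoscovici2025, §7 proof of Lemma 7.3] -/
theorem norm_prolateGuessMellin_sub_le {lam : ℝ} {f0 f4 : ℝ → ℝ} (h0 : IsProlateFunction lam 0 f0)
    (h4 : IsProlateFunction lam 4 f4) (hint : ∫ t in (0 : ℝ)..lam, prolateGuessH lam f0 f4 t = 0)
    {L : ℝ≥0} {M : ℝ} (hL : LipschitzOnWith L (prolateGuessH lam f0 f4) (Icc 0 lam))
    (hM : ∀ t ∈ Icc 0 lam, |prolateGuessH lam f0 f4 t| ≤ M)
    {s : ℂ} (hs : -(1 / 2 : ℝ) < s.re) (hs1 : s ≠ 1 / 2) :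
    ‖prolateGuessMellin lam f0 f4 s
        - riemannZeta (s + 1 / 2) * mellin (fun x ↦ (prolateGuessH lam f0 f4 x : ℂ)) (s + 1 / 2)‖ ≤
      (L * lam + M) * lam ^ (-(s.re + 1 / 2)) / (s.re + 1 / 2) := by
  have hlam : 0 < lam := h0.lam_pos
  obtain ⟨-, hsupp⟩ := prolateGuessH_lipschitz_support h0 h4
  have h := norm_setIntegral_Icc_connesE_sub_le hlam hL hsupp hM hint hs hs1 (one_div_pos.mpr hlam)
  unfold prolateGuessMellin
  rw [Real.rpow_neg hlam.le, ← Real.inv_rpow hlam.le, ← one_div]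
  exact h

/-- `norm_prolateGuessMellin_sub_le` with `∫_0^λ h_λ = 0` discharged by evenness of `h_{0,λ}, h_{4,λ}`
and `∫ h_{0,λ} ≠ 0` (`integral_zero_lam_prolateGuessH_eq_zero`). [cite: Connes2026Letter, §6.3–6.4] -/
theorem norm_prolateGuessMellin_sub_le_of_even {lam : ℝ} {f0 f4 : ℝ → ℝ}
    (h0 : IsProlateFunction lam 0 f0) (h4 : IsProlateFunction lam 4 f4)
    (he0 : ∀ x, f0 (-x) = f0 x) (he4 : ∀ x, f4 (-x) = f4 x) (hI : (∫ y in (-lam)..lam, f0 y) ≠ 0)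
    {L : ℝ≥0} {M : ℝ} (hL : LipschitzOnWith L (prolateGuessH lam f0 f4) (Icc 0 lam))
    (hM : ∀ t ∈ Icc 0 lam, |prolateGuessH lam f0 f4 t| ≤ M)
    {s : ℂ} (hs : -(1 / 2 : ℝ) < s.re) (hs1 : s ≠ 1 / 2) :
    ‖prolateGuessMellin lam f0 f4 s
        - riemannZeta (s + 1 / 2) * mellin (fun x ↦ (prolateGuessH lam f0 f4 x : ℂ)) (s + 1 / 2)‖ ≤
      (L * lam + M) * lam ^ (-(s.re + 1 / 2)) / (s.re + 1 / 2) :=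
  norm_prolateGuessMellin_sub_le h0 h4 (integral_zero_lam_prolateGuessH_eq_zero h0 h4 he0 he4 hI)
    hL hM hs hs1

/-- **Rate for the truncation in terms of the total variation of `h_λ`.**  With
`V_λ = TV(h_λ; [0, λ])` (`eVariationOn`, finite since `h_λ` is `C²`), `M` any bound of `|h_λ|` on
`[0, λ]`, `∫_0^λ h_λ = 0`, `σ = Re s > −½`, `s ≠ ½`:
`‖M_λ(s) − ζ(½+s)·𝓜h_λ(s+½)‖ = ‖B_λ(s)‖ ≤ (V_λ + M) · λ^{-(σ+½)} / (σ+½)`.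
This is the crude bound `|4B_λ(s)| ≤ 4·TV(h_λ)·λ^{-½-σ}/(½+σ)` of analyses of the Letter's Fact 6.4
(with the printed rate `λ^{-½-σ}`); the behaviour of `V_λ`, `M` as `λ → ∞` is prolate asymptotics and is
not addressed. [cite: ConnesConsaniMoscovici2025, §7 proof of Lemma 7.3] -/
theorem norm_prolateGuessMellin_sub_le_of_bv {lam : ℝ} {f0 f4 : ℝ → ℝ} (h0 : IsProlateFunction lam 0 f0)
    (h4 : IsProlateFunction lam 4 f4) (hint : ∫ t in (0 : ℝ)..lam, prolateGuessH lam f0 f4 t = 0)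
    {M : ℝ} (hM : ∀ t ∈ Icc 0 lam, |prolateGuessH lam f0 f4 t| ≤ M)
    {s : ℂ} (hs : -(1 / 2 : ℝ) < s.re) (hs1 : s ≠ 1 / 2) :
    ‖prolateGuessMellin lam f0 f4 s
        - riemannZeta (s + 1 / 2) * mellin (fun x ↦ (prolateGuessH lam f0 f4 x : ℂ)) (s + 1 / 2)‖ ≤
      ((eVariationOn (prolateGuessH lam f0 f4) (Icc 0 lam)).toReal + M)
        * lam ^ (-(s.re + 1 / 2)) / (s.re + 1 / 2) := by
  have hlam : 0 < lam := h0.lam_pos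
  obtain ⟨⟨L, hL⟩, hsupp⟩ := prolateGuessH_lipschitz_support h0 h4
  have h := norm_setIntegral_Icc_connesE_sub_le_of_bv hlam hL hsupp hM hint hs hs1
    (one_div_pos.mpr hlam)
  unfold prolateGuessMellin
  rw [Real.rpow_neg hlam.le, ← Real.inv_rpow hlam.le, ← one_div]
  exact h

/-- `norm_prolateGuessMellin_sub_le_of_bv` with `∫_0^λ h_λ = 0` discharged by evenness of
`h_{0,λ}, h_{4,λ}` and `∫ h_{0,λ} ≠ 0`. [cite: Connes2026Letter, §6.3–6.4] -/
theorem norm_prolateGuessMellin_sub_le_of_bv_of_even {lam : ℝ} {f0 f4 : ℝ → ℝ}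
    (h0 : IsProlateFunction lam 0 f0) (h4 : IsProlateFunction lam 4 f4)
    (he0 : ∀ x, f0 (-x) = f0 x) (he4 : ∀ x, f4 (-x) = f4 x) (hI : (∫ y in (-lam)..lam, f0 y) ≠ 0)
    {M : ℝ} (hM : ∀ t ∈ Icc 0 lam, |prolateGuessH lam f0 f4 t| ≤ M)
    {s : ℂ} (hs : -(1 / 2 : ℝ) < s.re) (hs1 : s ≠ 1 / 2) :
    ‖prolateGuessMellin lam f0 f4 s
        - riemannZeta (s + 1 / 2) * mellin (fun x ↦ (prolateGuessH lam f0 f4 x : ℂ)) (s + 1 / 2)‖ ≤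
      ((eVariationOn (prolateGuessH lam f0 f4) (Icc 0 lam)).toReal + M)
        * lam ^ (-(s.re + 1 / 2)) / (s.re + 1 / 2) :=
  norm_prolateGuessMellin_sub_le_of_bv h0 h4 (integral_zero_lam_prolateGuessH_eq_zero h0 h4 he0 he4 hI)
    hM hs hs1

end Literature.NumberTheory.LFunctions
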